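import Literature.NumberTheory.ConnesConsani2021.ArchimedeanSoninTrace
import Literature.NumberTheory.LFunctions.WeilArchimedeanPositivityProofs
import Literature.NumberTheory.LFunctions.WeilArchimedeanPositivityHolds
import Literature.NumberTheory.LFunctions.WeilExplicitArchTermProofs
import Literature.NumberTheory.LFunctions.WeilExplicitFormulaProofs
import HarnessLib

/-!
# Connes–Consani 2021, the archimedean place — the normalisation `QW = Q` on `V` and Corollary 2, PROVED

A. Connes, C. Consani, *Weil positivity and trace formula, the archimedean place*, Selecta Math.
(N.S.) 27 (2021) 77 (= arXiv:2006.13771) [bib: `ConnesConsani2021`], Introduction pp. 3–4.  Sibling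
of the statement layer `ArchimedeanSoninTrace.lean` (which stays free of the heavy analytic imports);
cell `pub-rhdoor`, seat cc-2.  Everything here is PROVED from the tree (no new named fact):

* `weilQuadratic_eq_polarTerm_add_archW`, `weilQuadratic_eq_archW` — the printed sentence (Intro
  p. 4, eq. (2)): Yoshida's positivity "is equivalent to the positivity of the quadratic form
  `QW(g) := W_∞(g ∗ g*)` defined on the vector space `V` of smooth functions with support in the
  interval `[2^{-1/2}, 2^{1/2}]` and whose Fourier transform vanishes at `i/2`": on that support NO
  PRIME enters Weil's functional (`weilPrimeTerm_eq_zero_of_tsupport_subset`) and the polar term of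
  `g ⋆ g*` is `2 Re(ĝ(0) \overline{ĝ(1)})`, which vanishes when `f̂(i/2) = ĝ(1) = 0`; so on `V` the
  tree's `Q(g) = W(g ⋆ g̃)` (`weilQuadratic`, NORMALISATION §0 of the cell) IS `W_∞(g ∗ g*)` — the
  factor-`1` row "CC 2021" of the cell's conversion table, now a theorem.
* `archW_weilConv_nonneg` — "This result was proved in [Yoshida]" (Intro p. 3–4): `QW ≥ 0` on `V`, from
  the tree's PROVED `weilPositivityOn_log_two_half_holds` (Yoshida 1992 Thm. 1 on `C((log 2)/2)`).
* `weilArchPositivity_soninTrace_fine_iff_weilQuadratic` — eq. (4) / Thm. 6.11 may be read with `Q(g)`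
  in place of `W_∞(g ∗ g*)` (PROVED equivalence of typed forms).
* `corollary_two_of_fine` — **Corollary 2** (Intro p. 4): "Let `g ∈ C_c^∞([2^{-1/2},2^{1/2}])` with
  `ĝ(i/2) = 0` and let `Z = ½ + iS` be the multi-set of non-trivial zeros of the Riemann zeta
  function. Then `c|ĝ(0)|² + Σ_{s∈S} ĝ(s)\overline{ĝ(s̄)} ≥ Tr(ϑ(g)𝐒ϑ(g)*)`", which the source obtains
  from eq. (4) "together with (explicit formula)"; PROVED here as the implication
  `WeilArchPositivity_soninTrace_fine → (Cor. 2)` using the tree's PROVED explicit formula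
  (`explicit_formula_holds`).  Dictionary for the zero sum: with `ρ = ½ + is`, CC's
  `ĝ(s) = f̂(s) = ĝ_tree(1 − ρ)` and `\overline{ĝ(s̄)} = conj ĝ_tree(ρ̄)`, so by the conjugation symmetry
  of the zeros `Σ_{s∈S} ĝ(s)\overline{ĝ(s̄)} = conj Σ_ρ m(ρ) (g⋆g̃)^(ρ)`; the typed statement uses the
  tree's symmetric zero sum `Z` of `g ⋆ g̃` (`HasWeilZeroSide`, Bombieri's `|Im ρ| ≤ T → ∞`) through its
  real part, on which the conjugation is invisible (and `Z = Q(g)` is real anyway).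
-/

noncomputable section

open _root_.MeasureTheory Complex Set Filter
open scoped Real ComplexConjugate Topology

namespace Literature.NumberTheory.ConnesConsani2021

open Literature.NumberTheory.LFunctions

/-- CC's support window in the additive variable: `supp g ⊆ [-(log 2)/2, (log 2)/2]` gives
`supp (g ⋆ g*) ⊆ [-log 2, log 2]`. [cite: ConnesConsani2021, Intro p. 4 (support `[2^{-1/2}, 2^{1/2}]`, `f = g ∗ g*` supported in `(1/2, 2)`)] -/
theorem tsupport_weilConv_weilReflect_subset_log_two {g : ℝ → ℂ} (hg : IsWeilTest g)
    (hsupp : tsupport g ⊆ Icc (-(Real.log 2 / 2)) (Real.log 2 / 2)) :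
    tsupport (weilConv g (weilReflect g)) ⊆ Icc (-Real.log 2) (Real.log 2) := by
  have h := tsupport_weilConv_weilReflect_subset hg.2 hsupp
  rwa [show 2 * (Real.log 2 / 2) = Real.log 2 by ring] at h

/-- **On CC's support no prime enters**: for `supp g ⊆ [-(log 2)/2, (log 2)/2]`,
`Q(g) = W(g ⋆ g̃) = 2 Re(ĝ(0)\overline{ĝ(1)}) + W_∞(g ∗ g*)` (polar term of `g ⋆ g̃` plus CC's
archimedean functional; the prime term vanishes). [cite: ConnesConsani2021, Intro p. 4 eq. (2)] -/
theorem weilQuadratic_eq_polarTerm_add_archW {g : ℝ → ℂ} (hg : IsWeilTest g)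
    (hsupp : tsupport g ⊆ Icc (-(Real.log 2 / 2)) (Real.log 2 / 2)) :
    weilQuadratic g =
      ((2 * (weilMellin g 0 * conj (weilMellin g 1)).re : ℝ) : ℂ) +
        archW (weilConv g (weilReflect g)) := by
  have hΘ : IsWeilTest (weilConv g (weilReflect g)) := hg.weilConv hg.weilReflect
  have hprime : weilPrimeTerm (weilConv g (weilReflect g)) = 0 :=
    weilPrimeTerm_eq_zero_of_tsupport_subset hΘ.1.continuous
      (tsupport_weilConv_weilReflect_subset_log_two hg hsupp)
  unfold weilQuadratic weilFunctional
  rw [hprime, sub_zero, weilPolarTerm_weilConv_weilReflect hg, archW,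
    weilArchTermBombieri_eq_weilArchTerm_holds hΘ]

/-- **`QW = Q` on `V`** (Intro p. 4, eq. (2)): for `g` supported in `[2^{-1/2}, 2^{1/2}]` with
`f̂(i/2) = 0` (i.e. `ĝ(1) = 0`), Weil's quadratic functional `Q(g) = W(g ⋆ g̃)` of the tree equals CC's
`QW(g) = W_∞(g ∗ g*)` — conversion factor `1`. [cite: ConnesConsani2021, Intro p. 4 eq. (2)] -/
theorem weilQuadratic_eq_archW {g : ℝ → ℂ} (hg : IsWeilTest g)
    (hsupp : tsupport g ⊆ Icc (-(Real.log 2 / 2)) (Real.log 2 / 2))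
    (h1 : mulFourier g (I / 2) = 0) :
    weilQuadratic g = archW (weilConv g (weilReflect g)) := by
  rw [mulFourier_I_half] at h1
  rw [weilQuadratic_eq_polarTerm_add_archW hg hsupp, h1]
  simp

/-- **Yoshida's positivity as quoted by CC** (Intro pp. 3–4: "This result was proved in [Yoshida] …
It is equivalent to the positivity of the quadratic form `QW(g) := W_∞(g ∗ g*)` defined on … `V`"):
`W_∞(g ∗ g*) ≥ 0` for `g ∈ V`.  PROVED from the tree's `weilPositivityOn_log_two_half_holds`
(Yoshida 1992, Thm. 1 on `C((log 2)/2)`, kernel-certified). [cite: ConnesConsani2021, Intro pp. 3–4 eq. (2); Yoshida1992 Thm. 1] -/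
theorem archW_weilConv_nonneg {g : ℝ → ℂ} (hg : IsWeilTest g)
    (hsupp : tsupport g ⊆ Icc (-(Real.log 2 / 2)) (Real.log 2 / 2))
    (h1 : mulFourier g (I / 2) = 0) :
    0 ≤ (archW (weilConv g (weilReflect g))).re := by
  rw [← weilQuadratic_eq_archW hg hsupp h1]
  exact weilPositivityOn_log_two_half_holds g hg hsupp

/-- Eq. (4) / Theorem 6.11 read with the tree's `Q(g)` in place of `W_∞(g ∗ g*)` (same statement on
`V`, by `weilQuadratic_eq_archW`). [cite: ConnesConsani2021, eq. (4) p. 4] -/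
theorem weilArchPositivity_soninTrace_fine_iff_weilQuadratic :
    WeilArchPositivity_soninTrace_fine ↔
      ∃ c : ℝ, c < 17 ∧
        ∀ g : ℝ → ℂ, IsWeilTest g →
          tsupport g ⊆ Icc (-(Real.log 2 / 2)) (Real.log 2 / 2) →
          mulFourier g (I / 2) = 0 →
          ∀ (n : ℕ) (ξ : Fin n → Lp ℂ 2 (volume : Measure ℝ)),
            Orthonormal ℂ ξ → (∀ i, ξ i ∈ soninSpace 1 1) →
              ∑ i, (soninTraceForm (weilConv g (weilReflect g)) (ξ i : ℝ → ℂ)).re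
                  - c * ‖mulFourier g 0‖ ^ 2
                ≤ (weilQuadratic g).re := by
  unfold WeilArchPositivity_soninTrace_fine
  constructor
  · rintro ⟨c, hc, H⟩
    refine ⟨c, hc, fun g hg hsupp h1 n ξ hξ hS => ?_⟩
    rw [weilQuadratic_eq_archW hg hsupp h1]
    exact H g hg hsupp h1 n ξ hξ hS
  · rintro ⟨c, hc, H⟩
    refine ⟨c, hc, fun g hg hsupp h1 n ξ hξ hS => ?_⟩
    rw [← weilQuadratic_eq_archW hg hsupp h1]
    exact H g hg hsupp h1 n ξ hξ hS

/-- On `V` the symmetric zero sum of `g ⋆ g̃` (when it converges to `Z`) IS `W_∞(g ∗ g*)`: explicit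
formula (tree, PROVED) + `QW = Q`. [cite: ConnesConsani2021, Intro p. 4 ("(4) together with (explicit formula) imply" Cor. 2)] -/
theorem zeroSide_eq_archW {g : ℝ → ℂ} (hg : IsWeilTest g)
    (hsupp : tsupport g ⊆ Icc (-(Real.log 2 / 2)) (Real.log 2 / 2))
    (h1 : mulFourier g (I / 2) = 0) {Z : ℂ}
    (hZ : HasWeilZeroSide (weilConv g (weilReflect g)) Z) :
    Z = archW (weilConv g (weilReflect g)) := by
  have hΘ : IsWeilTest (weilConv g (weilReflect g)) := hg.weilConv hg.weilReflect
  have hEF : HasWeilZeroSide (weilConv g (weilReflect g))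
      (weilFunctional (weilConv g (weilReflect g))) := explicit_formula_holds hΘ
  have hZW : Z = weilFunctional (weilConv g (weilReflect g)) := tendsto_nhds_unique hZ hEF
  rw [hZW, ← weilQuadratic_eq_archW hg hsupp h1]
  rfl

/-- **Connes–Consani 2021, Corollary 2** (Intro p. 4), PROVED as a consequence of eq. (4) /
Thm. 6.11 (the typed fact `WeilArchPositivity_soninTrace_fine`) and the explicit formula (PROVED in
the tree): "Let `g ∈ C_c^∞([2^{-1/2},2^{1/2}])` with `ĝ(i/2) = 0` and let `Z = ½ + iS` be the multi-set
of non-trivial zeros of the Riemann zeta function. Then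
`c|ĝ(0)|² + Σ_{s∈S} ĝ(s)\overline{ĝ(s̄)} ≥ Tr(ϑ(g)𝐒ϑ(g)*)`."  Typed: for every such `g` and every `Z`
to which the symmetric zero sum `Σ_{|Im ρ|≤T} m(ρ)(g⋆g̃)^(ρ)` converges (it does, to `W(g⋆g̃)`, by the
explicit formula), every partial Sonin-trace sum minus `c|f̂(0)|²` is `≤ Re Z` (module docstring:
`Σ_{s∈S} ĝ(s)\overline{ĝ(s̄)} = conj Z`, same real part). [cite: ConnesConsani2021, Cor. 2 p. 4] -/
theorem corollary_two_of_fine (h : WeilArchPositivity_soninTrace_fine) :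
    ∃ c : ℝ, c < 17 ∧
      ∀ g : ℝ → ℂ, IsWeilTest g →
        tsupport g ⊆ Icc (-(Real.log 2 / 2)) (Real.log 2 / 2) →
        mulFourier g (I / 2) = 0 →
        ∀ Z : ℂ, HasWeilZeroSide (weilConv g (weilReflect g)) Z →
          ∀ (n : ℕ) (ξ : Fin n → Lp ℂ 2 (volume : Measure ℝ)),
            Orthonormal ℂ ξ → (∀ i, ξ i ∈ soninSpace 1 1) →
              ∑ i, (soninTraceForm (weilConv g (weilReflect g)) (ξ i : ℝ → ℂ)).re
                  - c * ‖mulFourier g 0‖ ^ 2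
                ≤ Z.re := by
  obtain ⟨c, hc, H⟩ := h
  refine ⟨c, hc, fun g hg hsupp h1 Z hZ n ξ hξ hS => ?_⟩
  rw [zeroSide_eq_archW hg hsupp h1 hZ]
  exact H g hg hsupp h1 n ξ hξ hS

/-- Unconditionally (from Yoshida's PROVED positivity and the explicit formula): on `V` the symmetric
zero sum of `g ⋆ g̃` has non-negative real part — the `c = 0`, empty-family shadow of Corollary 2
that does not need eq. (4). [cite: ConnesConsani2021, Intro pp. 3–4; Yoshida1992 Thm. 1] -/
theorem zeroSide_re_nonneg {g : ℝ → ℂ} (hg : IsWeilTest g)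
    (hsupp : tsupport g ⊆ Icc (-(Real.log 2 / 2)) (Real.log 2 / 2))
    (h1 : mulFourier g (I / 2) = 0) {Z : ℂ}
    (hZ : HasWeilZeroSide (weilConv g (weilReflect g)) Z) : 0 ≤ Z.re := by
  rw [zeroSide_eq_archW hg hsupp h1 hZ]
  exact archW_weilConv_nonneg hg hsupp h1

end Literature.NumberTheory.ConnesConsani2021

end
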